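import Mathlib
import Summits.AtomisticToContinuum.HydrodynamicLimit.Theorems.ImplosionDichotomyDenseExcursionSonicCavityDefs
import Summits.AtomisticToContinuum.HydrodynamicLimit.Theorems.ImplosionDichotomyDenseExcursionR2Modes
import Summits.AtomisticToContinuum.HydrodynamicLimit.Theorems.ImplosionDichotomyDenseExcursionSonicPinnedGlue

/-!
# The pinned BCG profile, II: the witness of `stub_boxPackage` with its speed in the certified shooting
# window, its equations in original form and its SONIC NORMALISATION (crux `DenseExcursion`,
# line `sonic-cavity-renewal`, brick `exists_pinnedProfile`)

Helper file (`--supports stmt-AtomisticToContinuum-12586`) for the registered stub `stub_boxPackage` of the line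
`sonic-cavity-renewal` (crux `Summit.AtomisticToContinuum.HydrodynamicLimit.Theses.ImplosionDichotomy.DenseExcursion`).
Sequel of `…SonicPinnedGlue.lean` (`exists_meetingWZ`: the global `(W, Z)` orbit of the successful shooting for some
`r ∈ [r_d, r_u] = [17307/15625, 89409/80000]`, equal near `T₀` to the analytic branch through `P_s`, `D_Z < 0` before and
`D_Z > 0` after `T₀`).

* `exists_sonicWZ` — the `ξ`-translation `ξ ↦ ξ + T₀` (the system (1.8) is autonomous; the origin germ rescales to
  `ζ ↦ e^{−T₀}·𝒲₀(e^{T₀}ζ)`, still analytic and positive at `0`): the sonic point now sits at `ξ = 0`, where `(W, Z)`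
  IS the analytic branch `(W^{(r)}, Z^{(r)})` of Props. 2.2–2.3;
* `profileData_of_WZ` — adapted from `thm11_monatomic_of_WZ` + `thm11_monatomic_of_profile` (Literature files
  `CompressibleEulerImplosionAssembly.lean`, `…Proofs.lean`) with the witnesses EXPOSED: the radial profiles `U` (odd part) and
  `S` (even part) of `𝒲 = profileOfWZ W Z`, with the six clauses of the named fact `BuckmasterCaolaboraGomezserrano2025_thm11_monatomic`
  AND the dictionary to the line's variables `wOf U = −(W+Z)/2`, `sOf S = (W−Z)/6` (`…R2Profile`);
* `exists_pinnedProfile` (registered brick) — the witness `(r, wOf U, sOf S)` of `stub_profileEqs` re-assembled with the sharper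
  window and the sonic data: `IsMonatomicProfile` (`isMonatomicProfile_wOf_sOf`), `OrigProfileEqs` (`origProfileEqs_of_bcg`),
  `W 0 + S 0 = 1` (`W + S = 1 − D_Z`, `D_Z(P_s) = 0`), the sign structure `W + S > 1` for `x < 0`, `< 1` for `x > 0`
  (first three clauses of `CavityTube` (a)), the exact repulsivity `(W + S)′(0) = −κ(r)`, `κ(r) = 2 − r − √(2(r−1))`
  (branch slopes `W₁ + 2Z₁ = 3(2 − r − p)`, BCG (2.6); NOTE `κ ≥ 2/5 ⇔ r ≤ (26 − √220)/10 = 1.11676…`, true at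
  `r₂ = 1.11282` but NOT on the whole shooting window, whose top is `1.11761`), the exact sonic value
  `W(0) = (r − √(r² − 6r + 6))/2`, and analyticity of `W`, `S` at the sonic point.

Sources: Buckmaster–Cao-Labora–Gómez-Serrano 2025, Thm 1.1, §2.1 (P_s, (2.6)), Props. 2.2–2.3, §6.
-/

noncomputable section

open Set Filter Metric Topology
open scoped ContDiff

namespace Summit.AtomisticToContinuum.HydrodynamicLimit.Theorems.SonicCavityRenewal

open Literature.MathematicalPhysics.KineticTheory (V3)
open Literature.Analysis.FluidPDE.BuckmasterCaolaboraGomezserrano2025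
open Literature.Analysis.FluidPDE.BuckmasterCaolaboraGomezserrano2025.Monatomic
open Literature.Analysis.FluidPDE.BuckmasterCaolaboraGomezserrano2025.Monatomic.SonicSeries
open Summit.AtomisticToContinuum.HydrodynamicLimit.Theorems.R2OneModeTwoConditions
open Summit.AtomisticToContinuum.HydrodynamicLimit.Theorems.KidderKnobMelnikov
  (differentiableAt_of_radialScalar differentiableAt_of_radialField)

/-! ## The sonic point moved to `ξ = 0` -/

/-- **The pinned orbit with its sonic point at `ξ = 0`.** Translate the orbit of `exists_meetingWZ` by `T₀`: for some
`r ∈ [17307/15625, 89409/80000]` a global `C^∞` solution `(W, Z)` of (1.8) with `Z < W`, `(W, Z) → (0, 0)`, an analytic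
positive origin germ, which near `0` IS the analytic branch `(W^{(r)}, Z^{(r)})` through `P_s`, with `D_Z < 0` on `ξ < 0` and
`D_Z > 0` on `ξ > 0`. [cite: BuckmasterCaolaboraGomezserrano2025, Thm 1.1, §6, Props. 2.2–2.3] -/
theorem exists_sonicWZ : ∃ r : ℝ, ((17307 / 15625 : ℝ) ≤ r ∧ r ≤ 89409 / 80000) ∧ ∃ (W Z : ℝ → ℝ),
    ContDiff ℝ ∞ W ∧ ContDiff ℝ ∞ Z ∧
    (∀ ξ, DW (W ξ) (Z ξ) * deriv W ξ = NW r (W ξ) (Z ξ) ∧ DZ (W ξ) (Z ξ) * deriv Z ξ = NZ r (W ξ) (Z ξ)) ∧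
    (∀ ξ, Z ξ < W ξ) ∧ Tendsto W atTop (𝓝 0) ∧ Tendsto Z atTop (𝓝 0) ∧
    (∃ g : ℝ → ℝ, AnalyticAt ℝ g 0 ∧ 0 < g 0 ∧ ∃ ε : ℝ, 0 < ε ∧
      ∀ ζ ∈ Ioo 0 ε, ζ * W (Real.log ζ) = g ζ ∧ -ζ * Z (Real.log ζ) = g (-ζ)) ∧
    W =ᶠ[𝓝 0] Wloc r ∧ Z =ᶠ[𝓝 0] Zloc r ∧
    (∀ ξ, ξ < 0 → DZ (W ξ) (Z ξ) < 0) ∧ (∀ ξ, 0 < ξ → 0 < DZ (W ξ) (Z ξ)) := by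
  obtain ⟨r, hr, W, Z, T₀, hW, hZ, heq, hWZ, hlW, hlZ, ⟨ε, hε, horigin⟩, hbW, hbZ, hneg, hpos⟩ :=
    exists_meetingWZ
  have hprof := originProfile_analytic (r := r) one_pos
  set c : ℝ := Real.exp T₀ with hc
  have hc0 : 0 < c := Real.exp_pos _
  have hshift : Tendsto (fun x : ℝ => x + T₀) (𝓝 0) (𝓝 T₀) := by
    have h := (tendsto_id (x := 𝓝 (0 : ℝ))).add_const T₀
    simpa using h
  refine ⟨r, hr, fun x => W (x + T₀), fun x => Z (x + T₀), hW.comp (contDiff_id.add contDiff_const),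
    hZ.comp (contDiff_id.add contDiff_const), fun ξ => ?_, fun ξ => hWZ _,
    hlW.comp (tendsto_atTop_add_const_right _ T₀ tendsto_id),
    hlZ.comp (tendsto_atTop_add_const_right _ T₀ tendsto_id),
    ⟨fun ζ => c⁻¹ * OriginSeries.profile r 1 (c * ζ), ?_, ?_, c⁻¹ * ε, by positivity, fun ζ hζ => ?_⟩,
    ?_, ?_, fun ξ hξ => hneg _ (by linarith), fun ξ hξ => hpos _ (by linarith)⟩
  · -- the equations (autonomous system)
    rw [deriv_comp_add_const, deriv_comp_add_const]; exact heq _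
  · -- the rescaled origin germ is analytic at `0`
    refine analyticAt_const.mul (hprof.1.comp_of_eq ?_ (by simp))
    exact analyticAt_const.mul analyticAt_id
  · -- and positive there
    simp only [mul_zero, hprof.2]; positivity
  · -- the origin germ after translation
    obtain ⟨hζ0, hζε⟩ := hζ
    have hcζ : c * ζ ∈ Ioo 0 ε := ⟨by positivity, by rwa [lt_inv_mul_iff₀ hc0] at hζε⟩
    obtain ⟨h1, h2⟩ := horigin (c * ζ) hcζ
    have hlog : Real.log ζ + T₀ = Real.log (c * ζ) := by
      rw [Real.log_mul hc0.ne' hζ0.ne', hc, Real.log_exp]; ring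
    beta_reduce
    rw [hlog, show c * -ζ = -(c * ζ) by ring, ← h1, ← h2]
    constructor <;> field_simp
  · -- near `0`, `W(· + T₀)` is the branch
    have h := hbW.comp_tendsto hshift
    refine h.trans (Eventually.of_forall fun x => ?_)
    simp
  · have h := hbZ.comp_tendsto hshift
    refine h.trans (Eventually.of_forall fun x => ?_)
    simp

/-! ## From the orbit to the radial profiles, witnesses exposed -/

-- adapted from Literature/Analysis/FluidPDE/CompressibleEulerImplosionAssembly.lean (`thm11_monatomic_of_WZ`) and
-- Literature/Analysis/FluidPDE/CompressibleEulerImplosionProofs.lean (`thm11_monatomic_of_profile`), conclusions opened up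
/-- **The radial profiles of a global orbit, with the dictionary.** Let `(W, Z) : ℝ → ℝ²` be a global `C^∞` solution of (1.8)
(multiplied form) with `Z < W`, `(W, Z) → (0, 0)`, whose profile pieces `ζ W(log ζ)`, `−ζ Z(log ζ)` agree on `(0, ε)` with
`g(ζ)`, `g(−ζ)` for a germ `g` analytic and positive at `0`. Then the odd/even parts `U = (𝒲 − 𝒲(−·))/2`, `S = (𝒲 + 𝒲(−·))/2`
of `𝒲 = profileOfWZ W Z (g 0)` satisfy the six clauses of the named fact `BuckmasterCaolaboraGomezserrano2025_thm11_monatomic`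
at THIS `r` (smooth radial fields on `ℝ³`, the `(U, S)` profile system for `ζ > 0`, `S > 0` on `[0, ∞)`, `U/ζ, S/ζ → 0`), and in
the line's variables `wOf U = −(W + Z)/2`, `sOf S = (W − Z)/6` pointwise.
[cite: BuckmasterCaolaboraGomezserrano2025, Thm 1.1, §1.3 eqs. (1.8)–(1.10), (2.13), Prop. 2.5] -/
theorem profileData_of_WZ {r : ℝ} {W Z : ℝ → ℝ} (hW : ContDiff ℝ ∞ W) (hZ : ContDiff ℝ ∞ Z)
    (heq : ∀ ξ, DW (W ξ) (Z ξ) * deriv W ξ = NW r (W ξ) (Z ξ) ∧ DZ (W ξ) (Z ξ) * deriv Z ξ = NZ r (W ξ) (Z ξ))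
    (hWZ : ∀ ξ, Z ξ < W ξ) (hlimW : Tendsto W atTop (𝓝 0)) (hlimZ : Tendsto Z atTop (𝓝 0))
    {g : ℝ → ℝ} (hg : AnalyticAt ℝ g 0) (hg0 : 0 < g 0) {ε : ℝ} (hε : 0 < ε)
    (horigin : ∀ ζ ∈ Ioo 0 ε, ζ * W (Real.log ζ) = g ζ ∧ -ζ * Z (Real.log ζ) = g (-ζ)) :
    ∃ U S : ℝ → ℝ,
      ContDiff ℝ ∞ (fun y : V3 => (U ‖y‖ / ‖y‖) • y) ∧ ContDiff ℝ ∞ (fun y : V3 => S ‖y‖) ∧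
      (∀ ζ : ℝ, 0 < ζ →
        (r - 1) * U ζ + (ζ + U ζ) * deriv U ζ + 1 / 3 * S ζ * deriv S ζ = 0 ∧
        (r - 1) * S ζ + (ζ + U ζ) * deriv S ζ + 1 / 3 * S ζ * (deriv U ζ + 2 * U ζ / ζ) = 0) ∧
      (∀ ζ : ℝ, 0 ≤ ζ → 0 < S ζ) ∧
      Tendsto (fun ζ => U ζ / ζ) atTop (𝓝 0) ∧ Tendsto (fun ζ => S ζ / ζ) atTop (𝓝 0) ∧
      ∀ x, wOf U x = -(W x + Z x) / 2 ∧ sOf S x = (W x - Z x) / 6 := by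
  set 𝒲 : ℝ → ℝ := profileOfWZ W Z (g 0) with h𝒲
  have hposdef : ∀ ζ : ℝ, 0 < ζ → 𝒲 ζ = ζ * W (Real.log ζ) := fun ζ hζ => profileOfWZ_pos hζ
  have hnegdef : ∀ ζ : ℝ, ζ < 0 → 𝒲 ζ = ζ * Z (Real.log (-ζ)) := fun ζ hζ => profileOfWZ_neg hζ
  have h0 : 𝒲 0 = g 0 := profileOfWZ_zero
  have hWd : Differentiable ℝ W := hW.differentiable (by simp)
  have hZd : Differentiable ℝ Z := hZ.differentiable (by simp)
  -- (a) analyticity at `ζ = 0`: `𝒲 = g` on `(-ε, ε)`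
  have hnear : ∀ ζ ∈ Ioo (-ε) ε, 𝒲 ζ = g ζ := by
    intro ζ hζ
    rcases lt_trichotomy ζ 0 with hlt | rfl | hgt
    · have h := (horigin (-ζ) ⟨by linarith, by linarith [hζ.1]⟩).2
      rw [hnegdef ζ hlt]
      simpa using h
    · exact h0
    · rw [hposdef ζ hgt]
      exact (horigin ζ ⟨hgt, hζ.2⟩).1
  have h_an : AnalyticAt ℝ 𝒲 0 := by
    have hev : 𝒲 =ᶠ[𝓝 0] g := by
      filter_upwards [Ioo_mem_nhds (show -ε < 0 by linarith) hε] with ζ hζ using hnear ζ hζ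
    exact hg.congr hev.symm
  -- (b) smoothness away from `ζ = 0`
  have h_sm : ∀ ζ ≠ 0, ContDiffAt ℝ ∞ 𝒲 ζ := by
    intro ζ hζ
    rcases lt_or_gt_of_ne hζ with hlt | hgt
    · have hev : 𝒲 =ᶠ[𝓝 ζ] fun x => x * Z (Real.log (-x)) := by
        filter_upwards [Iio_mem_nhds hlt] with x hx using hnegdef x hx
      refine ContDiffAt.congr_of_eventuallyEq ?_ hev
      have hlog : ContDiffAt ℝ ∞ (fun x => Real.log (-x)) ζ :=
        (Real.contDiffAt_log.mpr (by linarith : -ζ ≠ 0)).comp ζ contDiffAt_id.neg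
      exact contDiffAt_id.mul (hZ.contDiffAt.comp ζ hlog)
    · have hev : 𝒲 =ᶠ[𝓝 ζ] fun x => x * W (Real.log x) := by
        filter_upwards [Ioi_mem_nhds hgt] with x hx using hposdef x hx
      refine ContDiffAt.congr_of_eventuallyEq ?_ hev
      exact contDiffAt_id.mul (hW.contDiffAt.comp ζ (Real.contDiffAt_log.mpr hgt.ne'))
  -- (c) the profile equation (1.10) off the origin
  have h_ode := profile_ode_of_WZ (r := r) hWd hZd
    (fun ξ => by have := (heq ξ).1; unfold DW NW at this; exact this)
    (fun ξ => by have := (heq ξ).2; unfold DZ NZ at this; exact this) hposdef hnegdef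
  -- (d) the odd / even germs at `0`
  obtain ⟨ge, ho, hge, hho, hgh⟩ := exists_sq_repr_of_analyticAt h_an
  have hgh' : ∀ᶠ t in 𝓝 (0 : ℝ), 𝒲 (-t) = ge (t ^ 2) - t * ho (t ^ 2) := by
    have := (continuous_neg.tendsto' (0 : ℝ) 0 neg_zero).eventually hgh
    filter_upwards [this] with t ht
    rw [ht, neg_sq]
    ring
  -- the profiles: `U` = odd part (radial velocity), `S` = even part (rescaled sound speed)
  set U : ℝ → ℝ := fun t => (𝒲 t - 𝒲 (-t)) / 2 with hU
  set S : ℝ → ℝ := fun t => (𝒲 t + 𝒲 (-t)) / 2 with hS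
  have hUS_sm : ∀ t ≠ 0, ContDiffAt ℝ ∞ U t ∧ ContDiffAt ℝ ∞ S t := by
    intro t ht
    have h1 := h_sm t ht
    have h2 : ContDiffAt ℝ ∞ (fun s => 𝒲 (-s)) t :=
      (h_sm (-t) (neg_ne_zero.mpr ht)).comp t contDiff_neg.contDiffAt
    exact ⟨(h1.sub h2).div_const 2, (h1.add h2).div_const 2⟩
  have hU_repr : ∀ᶠ t in 𝓝 0, U t = t * ho (t ^ 2) := by
    filter_upwards [hgh, hgh'] with t h1 h2
    simp only [hU, h1, h2]
    ring
  have hS_repr : ∀ᶠ t in 𝓝 0, S t = ge (t ^ 2) := by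
    filter_upwards [hgh, hgh'] with t h1 h2
    simp only [hS, h1, h2]
    ring
  have hd : ∀ t ≠ 0, DifferentiableAt ℝ 𝒲 t := fun t ht => (h_sm t ht).differentiableAt (by simp)
  -- values on the two half-lines
  have hval : ∀ ζ : ℝ, 0 < ζ → 𝒲 ζ = ζ * W (Real.log ζ) ∧ 𝒲 (-ζ) = -ζ * Z (Real.log ζ) := by
    intro ζ hζ
    refine ⟨hposdef ζ hζ, ?_⟩
    rw [hnegdef (-ζ) (by linarith), neg_neg]
  refine ⟨U, S, ?_, ?_, ?_, ?_, ?_, ?_, fun x => ?_⟩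
  · -- smoothness of the radial velocity field `y ↦ U(|y|) y/|y|`
    exact contDiff_radialField_of_sq_repr (fun t ht => (hUS_sm t ht).1) hho hU_repr
  · -- smoothness of `y ↦ S(|y|)`
    exact contDiff_comp_norm_of_sq_repr (fun t ht => (hUS_sm t ht).2) hge hS_repr
  · -- the profile equations for `ζ > 0`
    intro ζ hζ
    have hζ' : ζ ≠ 0 := hζ.ne'
    have hdU : deriv U ζ = (deriv 𝒲 ζ + deriv 𝒲 (-ζ)) / 2 :=
      (hasDerivAt_oddPart (hd ζ hζ') (hd (-ζ) (neg_ne_zero.mpr hζ'))).deriv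
    have hdS : deriv S ζ = (deriv 𝒲 ζ - deriv 𝒲 (-ζ)) / 2 :=
      (hasDerivAt_evenPart (hd ζ hζ') (hd (-ζ) (neg_ne_zero.mpr hζ'))).deriv
    have h₁ := h_ode ζ hζ'
    have h₂ := h_ode (-ζ) (neg_ne_zero.mpr hζ')
    simp only [neg_neg] at h₂
    rw [hdU, hdS]
    exact US_system_of_profile_eq h₁ h₂
  · -- positivity of `S` on `[0, ∞)`
    intro ζ hζ
    show 0 < (𝒲 ζ + 𝒲 (-ζ)) / 2
    rcases eq_or_lt_of_le hζ with h | h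
    · subst h; rw [neg_zero, h0]; linarith
    · obtain ⟨h1, h2⟩ := hval ζ h
      rw [h1, h2]
      nlinarith [hWZ (Real.log ζ)]
  · -- `U/ζ → 0`
    have h_limW := tendsto_profile_div hlimW hposdef
    have h_limZ := tendsto_profile_neg_div hlimZ hnegdef
    have hlim := (h_limW.sub h_limZ).div_const 2
    rw [sub_zero, zero_div] at hlim
    refine hlim.congr' (Eventually.of_forall fun ζ => ?_)
    show (𝒲 ζ / ζ - 𝒲 (-ζ) / ζ) / 2 = (𝒲 ζ - 𝒲 (-ζ)) / 2 / ζ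
    ring
  · -- `S/ζ → 0`
    have h_limW := tendsto_profile_div hlimW hposdef
    have h_limZ := tendsto_profile_neg_div hlimZ hnegdef
    have hlim := (h_limW.add h_limZ).div_const 2
    rw [add_zero, zero_div] at hlim
    refine hlim.congr' (Eventually.of_forall fun ζ => ?_)
    show (𝒲 ζ / ζ + 𝒲 (-ζ) / ζ) / 2 = (𝒲 ζ + 𝒲 (-ζ)) / 2 / ζ
    ring
  · -- the dictionary at `ζ = eˣ`
    obtain ⟨h1, h2⟩ := hval (Real.exp x) (Real.exp_pos x)
    have hx : Real.exp x ≠ 0 := (Real.exp_pos x).ne'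
    simp only [wOf, sOf, hU, hS, h1, h2, Real.log_exp]
    constructor <;> field_simp <;> ring

/-! ## The brick: the pinned profile in the line's variables -/

/-- **Brick `exists_pinnedProfile` of stub `stub_boxPackage` (line `sonic-cavity-renewal`): THE PINNED PROFILE WITH ITS SONIC
NORMALISATION.** There are a speed `r` in the kernel-certified shooting window `[17307/15625, 89409/80000] ∋ r₂` and a profile
`(W, S)` (the change of variables `W = wOf U = −(W_c + Z_c)/2`, `S = sOf S_c = (W_c − Z_c)/6` of the BCG orbit of `exists_sonicWZ`)
with: `IsMonatomicProfile r W S`; the momentum and mass equations in original form (`OrigProfileEqs`); the sonic point AT `x = 0`: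
`W 0 + S 0 = 1` (`W + S = 1 − D_Z`), `W + S > 1` for `x < 0` and `W + S < 1` for `x > 0` (the first three clauses of `CavityTube` (a));
the exact repulsivity `W′(0) + S′(0) = −(2 − r − √(2(r−1)))` (`= −κ(r)`, from the branch slopes `(W₁, Z₁)` at `P_s`); the exact
sonic value `W(0) = (r − √(r² − 6r + 6))/2`; and real-analyticity of `W`, `S` at the sonic point (the analytic branch of BCG
Props. 2.2–2.3). [cite: BuckmasterCaolaboraGomezserrano2025, Thm 1.1, §2.1, Props. 2.2–2.3, §6] -/
theorem exists_pinnedProfile : ∃ (r : ℝ) (W S : ℝ → ℝ), ((17307 / 15625 : ℝ) ≤ r ∧ r ≤ 89409 / 80000) ∧ IsMonatomicProfile r W S ∧ OrigProfileEqs r W S ∧ W 0 + S 0 = 1 ∧ (∀ x, x < 0 → 1 < W x + S x) ∧ (∀ x, 0 < x → W x + S x < 1) ∧ deriv W 0 + deriv S 0 = -(2 - r - Real.sqrt (2 * (r - 1))) ∧ W 0 = (r - Real.sqrt (r ^ 2 - 6 * r + 6)) / 2 ∧ AnalyticAt ℝ W 0 ∧ AnalyticAt ℝ S 0 := by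
  obtain ⟨r, hr, Wc, Zc, hW, hZ, heq, hWZ, hlW, hlZ, ⟨g, hg, hg0, ε, hε, horigin⟩, hbW, hbZ, hneg, hpos⟩ :=
    exists_sonicWZ
  have hr₃ : 1.10102 < r := by norm_num at hr ⊢; linarith [hr.1]
  have hr₄ : r < 1.13476 := by norm_num at hr ⊢; linarith [hr.2]
  have h3 : r3 < r := lt_of_lt_of_le (by have := Shooting.r3_lt_rd; rwa [Shooting.rd_eq] at this) hr.1
  have h4 : r < r4 := lt_of_le_of_lt hr.2 (by have := Shooting.ru_lt_r4; rwa [Shooting.ru_eq] at this)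
  obtain ⟨U, S, hU3, hS3, hode, hSpos, hUinf, hSinf, hdict⟩ :=
    profileData_of_WZ hW hZ heq hWZ hlW hlZ hg hg0 hε horigin
  -- the dictionary as function identities
  have hWf : wOf U = fun x => -(Wc x + Zc x) / 2 := funext fun x => (hdict x).1
  have hSf : sOf S = fun x => (Wc x - Zc x) / 6 := funext fun x => (hdict x).2
  have hsum : ∀ x, wOf U x + sOf S x = 1 - DZ (Wc x) (Zc x) := fun x => by
    rw [(hdict x).1, (hdict x).2]; unfold DZ; ring
  -- the branch data at the sonic point
  obtain ⟨hW0, hZ0, hW1, hZ1, hspec⟩ := sonicSeries_spec' h3 h4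
  have hρ : |(0 : ℝ)| < sonicRad r := by rw [abs_zero]; exact sonicRad_pos (h4.trans r3_r4_mem.2.2)
  obtain ⟨hanW, hanZ, -, -⟩ := hspec 0 hρ
  have hWc0 : Wc 0 = W0 r := by rw [hbW.eq_of_nhds, hW0]
  have hZc0 : Zc 0 = Z0 r := by rw [hbZ.eq_of_nhds, hZ0]
  have hdWc : deriv Wc 0 = W1 r := by rw [hbW.deriv_eq, hW1]
  have hdZc : deriv Zc 0 = Z1 r := by rw [hbZ.deriv_eq, hZ1]
  have hWd : Differentiable ℝ Wc := hW.differentiable (by simp)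
  have hZd : Differentiable ℝ Zc := hZ.differentiable (by simp)
  have hdisc : 0 ≤ disc r := (disc_pos (h4.trans r3_r4_mem.2.2)).le
  refine ⟨r, wOf U, sOf S, hr, isMonatomicProfile_wOf_sOf hr₃ hr₄ hU3 hS3 hode hSpos hUinf hSinf, fun x => ?_, ?_,
    fun x hx => ?_, fun x hx => ?_, ?_, ?_, ?_, ?_⟩
  · -- the equations in original form
    have hζ : 0 < Real.exp x := Real.exp_pos x
    obtain ⟨h1, h2⟩ := hode (Real.exp x) hζ
    exact origProfileEqs_of_bcg (differentiableAt_of_radialField hU3 hζ) (differentiableAt_of_radialScalar hS3 hζ) h1 h2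
  · -- `W 0 + S 0 = 1`
    rw [hsum, hWc0, hZc0, DZ_Ps]; ring
  · -- `x < 0`: `D_Z < 0`
    rw [hsum]; linarith [hneg x hx]
  · -- `x > 0`: `D_Z > 0`
    rw [hsum]; linarith [hpos x hx]
  · -- the repulsivity `κ(r) = 2 - r - p(r)`
    have hdW : deriv (wOf U) 0 = -(deriv Wc 0 + deriv Zc 0) / 2 := by
      rw [hWf]
      exact (((hWd 0).hasDerivAt.add (hZd 0).hasDerivAt).neg.div_const 2).deriv
    have hdS : deriv (sOf S) 0 = (deriv Wc 0 - deriv Zc 0) / 6 := by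
      rw [hSf]
      exact (((hWd 0).hasDerivAt.sub (hZd 0).hasDerivAt).div_const 6).deriv
    rw [hdW, hdS, hdWc, hdZc]
    unfold W1 Z1 Monatomic.p
    ring
  · -- the sonic value `W(0) = (r - q)/2`
    rw [(hdict 0).1, hWc0, hZc0]
    unfold W0 Z0 Monatomic.q disc
    ring
  · -- analyticity at the sonic point
    rw [hWf]
    exact ((hanW.congr hbW.symm).add (hanZ.congr hbZ.symm)).neg.div_const
  · rw [hSf]
    exact ((hanW.congr hbW.symm).sub (hanZ.congr hbZ.symm)).div_const

/-- AFTER PINNING: the repulsivity `κ(r) = 2 − r − √(2(r−1))` of the `deriv` clause of `exists_pinnedProfile` is `≥ 2/5` as soon as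
`r ≤ 279/250 = 1.116`, no lower bound needed since `√` vanishes on negatives (the exact threshold is `(26 − √220)/10 = 1.11676…`; the shooting window's top `89409/80000 = 1.11761` is ABOVE it,
`r₂ = 1.11282` below): on any certified sub-window with right end `≤ 1.116` this yields clause (a).5 of `CavityTube`. [folklore] -/
theorem kappa_ge_two_fifths {r : ℝ} (h : r ≤ 279 / 250) : 2 / 5 ≤ 2 - r - Real.sqrt (2 * (r - 1)) := by
  have hs : Real.sqrt (2 * (r - 1)) ≤ 8 / 5 - r :=
    calc Real.sqrt (2 * (r - 1)) ≤ Real.sqrt ((8 / 5 - r) ^ 2) :=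
          Real.sqrt_le_sqrt (by nlinarith [mul_nonneg (sub_nonneg.2 h) (by linarith : (0 : ℝ) ≤ 1021 / 250 - r)])
      _ = 8 / 5 - r := Real.sqrt_sq (by linarith)
  linarith

end Summit.AtomisticToContinuum.HydrodynamicLimit.Theorems.SonicCavityRenewal

end
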